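import Mathlib.NumberTheory.ModularForms.CongruenceSubgroups
import Mathlib.Algebra.Group.Int.Even
import HarnessLib

/-!
# Line `kummer` on crux `StarGO2Sigma` (item stmt-BirchSwinnertonDyer-27046, route `EisensteinDepletionAtTwo`):
# stub `stub_characterOfGamma0` — a multiplicative parity functional on `Γ₀(N)` that is trivial on `{d ≡ 1 (mod N)}`
# is a function of the entry `d`

Cell `bsd-rank2` (HOME run/shared/lean/pub/bsd-rank2/), seat `bsd-rank2-eng-2` GEN 16; registered stub 3 of planner p2 GEN 32's
line `kummer` (skeleton `line-kummer.lean`, namespace `…Cruxes.StarGO2Sigma.Kummer`), proved VERBATIM (name + signature).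
Pure group theory of `Γ₀(N) → Γ₀(N)/Γ₁(N) ↪ (ℤ/N)ˣ`, `γ ↦ d(γ) mod N`: if `D : Γ₀(N) → Prop` satisfies
`D(γδ) ↔ (D γ ↔ D δ)` and `D γ` whenever `N ∣ d(γ) − 1`, then for `γ, γ'` with the same entry `d` one has
`(γ⁻¹γ')₂₂ = a d' − c b' = 1 + c(b − b') ≡ 1 (mod N)` (`ad − bc = 1`, `N ∣ c`), so `D(γ⁻¹γ')`, and with `D(γ⁻¹γ)` the
multiplicativity gives `D γ ↔ D γ'`; hence `D γ ↔ Even (e d(γ))` for `e d := [∃ γ, d(γ) = d ∧ ¬ D γ]`.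
HONEST FRAMING: elementary bookkeeping stub of an OPEN crux; StarGO2Sigma / E1M_NSF / BSD are NOT proved by this file
(PARTITION D-0054: none — r_an ≥ 2 axis S0, door T-r3₂).

References: F. Diamond, J. Shurman, *A First Course in Modular Forms*, GTM 228 (2005), §1.2 (`Γ₁(N) ⊴ Γ₀(N)`, (1.2.7))
[DiamondShurman2005].
-/

set_option linter.dupNamespace false
set_option autoImplicit false

namespace Summit.BirchSwinnertonDyer.BirchSwinnertonDyer.Theorems.DepletionAtTwo.KummerStubs

open scoped MatrixGroups
open CongruenceSubgroup

/-- Entry `(1,1)` of `γ⁻¹ γ'` in `SL(2, ℤ)`: `(γ⁻¹γ')₂₂ = a d' − c b'` (`γ = (a b; c d)`, `γ⁻¹ = (d −b; −c a)`). [folklore] -/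
private theorem inv_mul_apply_one_one (γ γ' : SL(2, ℤ)) :
    ((γ⁻¹ * γ' : SL(2, ℤ)) : Matrix (Fin 2) (Fin 2) ℤ) 1 1 =
      (γ : Matrix (Fin 2) (Fin 2) ℤ) 0 0 * (γ' : Matrix (Fin 2) (Fin 2) ℤ) 1 1 -
        (γ : Matrix (Fin 2) (Fin 2) ℤ) 1 0 * (γ' : Matrix (Fin 2) (Fin 2) ℤ) 0 1 := by
  rw [Matrix.SpecialLinearGroup.coe_mul, Matrix.SpecialLinearGroup.coe_inv, Matrix.adjugate_fin_two,
    Matrix.mul_apply, Fin.sum_univ_two]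
  simp only [Matrix.of_apply, Matrix.cons_val', Matrix.cons_val_zero, Matrix.cons_val_one,
    Matrix.empty_val', Matrix.cons_val_fin_one]
  ring

/-- **Stub `stub_characterOfGamma0` of line `kummer` (crux StarGO2Sigma, item 27046), VERBATIM.**  A predicate `D` on
`Γ₀(N)` with `D(γδ) ↔ (D γ ↔ D δ)` which holds on every `γ` with `N ∣ d(γ) − 1` satisfies `D γ ↔ Even (e d(γ))` for
some `e : ℤ → ℤ` (indeed `D` depends only on the entry `d(γ)`). [cite: DiamondShurman2005, §1.2 (1.2.7)] -/
theorem stub_characterOfGamma0 :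
    ∀ (N : ℕ) (D : Gamma0 N → Prop),
      (∀ γ δ : Gamma0 N, D (γ * δ) ↔ (D γ ↔ D δ)) →
      (∀ γ : Gamma0 N, (N : ℤ) ∣ (γ : SL(2, ℤ)) 1 1 - 1 → D γ) →
      ∃ e : ℤ → ℤ, ∀ γ : Gamma0 N, D γ ↔ Even (e ((γ : SL(2, ℤ)) 1 1)) := by
  intro N D hmul htriv
  classical
  -- same `d`-entry ⇒ same `D`-value
  have hkey : ∀ γ γ' : Gamma0 N, (γ : SL(2, ℤ)) 1 1 = (γ' : SL(2, ℤ)) 1 1 → (D γ ↔ D γ') := by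
    intro γ γ' hd
    have hc : (N : ℤ) ∣ (γ : SL(2, ℤ)) 1 0 := by
      have h := (Gamma0_mem (N := N) (A := (γ : SL(2, ℤ)))).mp γ.2
      exact (ZMod.intCast_zmod_eq_zero_iff_dvd _ N).mp h
    have hdet : (γ : Matrix (Fin 2) (Fin 2) ℤ) 0 0 * (γ : Matrix (Fin 2) (Fin 2) ℤ) 1 1 -
        (γ : Matrix (Fin 2) (Fin 2) ℤ) 0 1 * (γ : Matrix (Fin 2) (Fin 2) ℤ) 1 0 = 1 := by
      rw [← Matrix.det_fin_two]; exact (γ : SL(2, ℤ)).det_coe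
    have h1 : D (γ⁻¹ * γ') := by
      apply htriv
      rw [Subgroup.coe_mul, Subgroup.coe_inv, inv_mul_apply_one_one, ← hd]
      have e : (γ : Matrix (Fin 2) (Fin 2) ℤ) 0 0 * (γ : Matrix (Fin 2) (Fin 2) ℤ) 1 1 -
          (γ : Matrix (Fin 2) (Fin 2) ℤ) 1 0 * (γ' : Matrix (Fin 2) (Fin 2) ℤ) 0 1 - 1 =
          (γ : Matrix (Fin 2) (Fin 2) ℤ) 1 0 *
            ((γ : Matrix (Fin 2) (Fin 2) ℤ) 0 1 - (γ' : Matrix (Fin 2) (Fin 2) ℤ) 0 1) := by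
        linear_combination hdet
      rw [e]
      exact hc.mul_right _
    have h2 : D (γ⁻¹ * γ) := by
      apply htriv
      rw [inv_mul_cancel, Subgroup.coe_one]
      simp
    rw [hmul] at h1 h2
    exact h2.symm.trans h1
  refine ⟨fun d => if ∃ γ : Gamma0 N, (γ : SL(2, ℤ)) 1 1 = d ∧ ¬ D γ then 1 else 0, fun γ => ?_⟩
  by_cases hD : D γ
  · have hne : ¬ ∃ γ' : Gamma0 N, (γ' : SL(2, ℤ)) 1 1 = (γ : SL(2, ℤ)) 1 1 ∧ ¬ D γ' := by
      rintro ⟨γ', hd, hD'⟩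
      exact hD' ((hkey γ γ' hd.symm).mp hD)
    simp only [hne, if_false]
    exact iff_of_true hD ⟨0, rfl⟩
  · have he : ∃ γ' : Gamma0 N, (γ' : SL(2, ℤ)) 1 1 = (γ : SL(2, ℤ)) 1 1 ∧ ¬ D γ' := ⟨γ, rfl, hD⟩
    simp only [he, if_true]
    exact iff_of_false hD (by decide)

end Summit.BirchSwinnertonDyer.BirchSwinnertonDyer.Theorems.DepletionAtTwo.KummerStubs
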